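import Mathlib
import HarnessLib
import Summits.NavierStokesRegularity.NavierStokesRegularity.Theorems.ChiralWindowDoorDefs
import Summits.NavierStokesRegularity.NavierStokesRegularity.Theorems.ChiralWindowDoorProfileRigidityOfStubs
import Summits.NavierStokesRegularity.NavierStokesRegularity.Theorems.ChiralWindowDoorLocalHelicityLower
import Summits.NavierStokesRegularity.NavierStokesRegularity.Theorems.ChiralWindowDoorLocalDissipationLower

/-!
# Door S20 «ChiralWindowDoor» — the residue Liouville and K2 from the TWO remaining stubs B3 and B5a
# (B1′, B2′, B5b discharged in the tree)

Door S20 of nsreg-p1's local Type-I door family (`HOME/ns-regularity-ideate-p1/r19/R19-LINE.md`, line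
`r19/Sketch20v5.lean` 7f13084196f4f031; DESIGN-ONLY, route NOT born).  With B1′
(`…LocalHelicityLower.localHelicityLower`), B2′ (`…LocalDissipationLower.localDissipationLower`) and B5b
(`…EssLocalClass.essLocalClass`) PROVED, the compositions of `…ProfileRigidityOfStubs` specialise:

* `homochiralProfileRigidity_of_B3_B5a` — **the everywhere-form residue `HomochiralProfileRigidity` (text verbatim)
  FROM the texts of B3 `stub_helicityBudget` and B5a `stub_sobolevFatou` alone**;
* `chiralProfileRigidity_of_B3_B5a` — **K2 `ChiralProfileRigidity` (text verbatim) FROM B3, B5a and the analyticity of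
  `Λ` on door-class slices**;
* `target_of_K1_B3_B5a` — the door `Target` FROM K1, B3, B5a and the slice analyticity.

Seat nsreg-p6 g11 (THEOREMS-ONLY door sequels, DIRECTOR-NS g8 #32 (2)/#36).  WHAT THIS IS NOT: not NS regularity
(Clay A); B3, B5a, K1 and the analyticity input are NOT proved here — conditional compositions; no route is opened.
-/

noncomputable section

-- the summit and its single sub-problem share the name (CONVENTIONS §1), as in every Theorems file
set_option linter.dupNamespace false

namespace Summit.NavierStokesRegularity.NavierStokesRegularity.Theorems.ChiralWindowDoorProfileRigidityOfB3B5a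

open MeasureTheory Set Function Filter Topology Metric
open scoped NNReal ENNReal RealInnerProductSpace
open Literature.Analysis Literature.Analysis.FluidPDE
open Summit.NavierStokesRegularity.NavierStokesRegularity.Theorems.ChiralWindowDoorDefs
open Summit.NavierStokesRegularity.NavierStokesRegularity.Theorems.ChiralWindowDoorProfileRigidityOfStubs
open Summit.NavierStokesRegularity.NavierStokesRegularity.Theorems.ChiralWindowDoorLocalHelicityLower (localHelicityLower)
open Summit.NavierStokesRegularity.NavierStokesRegularity.Theorems.ChiralWindowDoorLocalDissipationLower
  (localDissipationLower)

/-- **The residue `HomochiralProfileRigidity` of `r19/Sketch20v5.lean` (text verbatim) FROM B3 and B5a** (B1′, B2′,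
B5b are tree theorems). -/
theorem homochiralProfileRigidity_of_B3_B5a
    (hB3 : ∀ (η : EuclideanSpace ℝ (Fin 3) → ℝ), IsAdmissibleBump η → ∀ (C D K : ℝ)
      (v : ℝ → EuclideanSpace ℝ (Fin 3) → EuclideanSpace ℝ (Fin 3)),
      HasTypeITimeDecay C v → HasTypeIDecay D v → HasTypeIDerivDecay K v →
      ContinuousOn (Function.uncurry v) (Set.Iio (0 : ℝ) ×ˢ Set.univ) →
      (∀ s t : ℝ, s < t → t < 0 → ∀ x,
          v t x = UnboundedOperators.heatExtension (v s) (t - s) x - oseenDuhamel 1 s v v t x) →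
      (∀ t < 0, VectorCalculus.IsDivFree (v t)) →
      ∃ c : ℝ, ∀ R > (0 : ℝ), ∀ t₀ < (0 : ℝ),
        locHelicity (bumpSq η R) (v t₀) + 2 * ∫ t in Set.Iio t₀, locHelicity (bumpSq η R) (curl (v t)) ≤ c)
    (hB5a : ∀ (η : EuclideanSpace ℝ (Fin 3) → ℝ), IsAdmissibleBump η → ∀ (C D K : ℝ)
      (v : ℝ → EuclideanSpace ℝ (Fin 3) → EuclideanSpace ℝ (Fin 3)),
      HasTypeITimeDecay C v → HasTypeIDecay D v → HasTypeIDerivDecay K v →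
      ContinuousOn (Function.uncurry v) (Set.Iio (0 : ℝ) ×ˢ Set.univ) →
      (∃ c : ℝ, ∀ R > (0 : ℝ), ∀ t₀ < (0 : ℝ), gagliardo (bumpSq η R) (v t₀) ≤ c) →
      ∃ M : NNReal, ∀ t ∈ Set.Ioo (-1 : ℝ) 0,
        ∫⁻ x in Metric.ball (0 : EuclideanSpace ℝ (Fin 3)) 1, ‖v t x‖ₑ ^ (3 : ℕ) ≤ M) :
    ∀ (C D K : ℝ) (v : ℝ → EuclideanSpace ℝ (Fin 3) → EuclideanSpace ℝ (Fin 3)), Literature.Analysis.FluidPDE.HasTypeITimeDecay C v → Literature.Analysis.FluidPDE.HasTypeIDecay D v → HasTypeIDerivDecay K v → ContinuousOn (Function.uncurry v) (Set.Iio (0 : ℝ) ×ˢ Set.univ) → (∀ s t : ℝ, s < t → t < 0 → ∀ x, v t x = Literature.Analysis.UnboundedOperators.heatExtension (v s) (t - s) x - Literature.Analysis.FluidPDE.oseenDuhamel 1 s v v t x) → (∀ t < 0, Literature.Analysis.FluidPDE.VectorCalculus.IsDivFree (v t)) → (∀ t < 0, IsChiral (v t)) → ¬ Literature.Analysis.FluidPDE.IsBackwardSingularPoint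 v 0 :=
  homochiralProfileRigidity_of_B localHelicityLower localDissipationLower hB3 hB5a

/-- **K2 `ChiralProfileRigidity` of `r19/Sketch20v5.lean` (text verbatim) FROM B3, B5a and the analyticity of `Λ` on
door-class slices.** -/
theorem chiralProfileRigidity_of_B3_B5a
    (hB3 : ∀ (η : EuclideanSpace ℝ (Fin 3) → ℝ), IsAdmissibleBump η → ∀ (C D K : ℝ)
      (v : ℝ → EuclideanSpace ℝ (Fin 3) → EuclideanSpace ℝ (Fin 3)),
      HasTypeITimeDecay C v → HasTypeIDecay D v → HasTypeIDerivDecay K v →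
      ContinuousOn (Function.uncurry v) (Set.Iio (0 : ℝ) ×ˢ Set.univ) →
      (∀ s t : ℝ, s < t → t < 0 → ∀ x,
          v t x = UnboundedOperators.heatExtension (v s) (t - s) x - oseenDuhamel 1 s v v t x) →
      (∀ t < 0, VectorCalculus.IsDivFree (v t)) →
      ∃ c : ℝ, ∀ R > (0 : ℝ), ∀ t₀ < (0 : ℝ),
        locHelicity (bumpSq η R) (v t₀) + 2 * ∫ t in Set.Iio t₀, locHelicity (bumpSq η R) (curl (v t)) ≤ c)
    (hB5a : ∀ (η : EuclideanSpace ℝ (Fin 3) → ℝ), IsAdmissibleBump η → ∀ (C D K : ℝ)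
      (v : ℝ → EuclideanSpace ℝ (Fin 3) → EuclideanSpace ℝ (Fin 3)),
      HasTypeITimeDecay C v → HasTypeIDecay D v → HasTypeIDerivDecay K v →
      ContinuousOn (Function.uncurry v) (Set.Iio (0 : ℝ) ×ˢ Set.univ) →
      (∃ c : ℝ, ∀ R > (0 : ℝ), ∀ t₀ < (0 : ℝ), gagliardo (bumpSq η R) (v t₀) ≤ c) →
      ∃ M : NNReal, ∀ t ∈ Set.Ioo (-1 : ℝ) 0,
        ∫⁻ x in Metric.ball (0 : EuclideanSpace ℝ (Fin 3)) 1, ‖v t x‖ₑ ^ (3 : ℕ) ≤ M)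
    (hΛ : ∀ (C D K : ℝ) (v : ℝ → EuclideanSpace ℝ (Fin 3) → EuclideanSpace ℝ (Fin 3)),
      HasTypeITimeDecay C v → HasTypeIDecay D v → HasTypeIDerivDecay K v →
      ContinuousOn (Function.uncurry v) (Set.Iio (0 : ℝ) ×ˢ Set.univ) →
      (∀ s t : ℝ, s < t → t < 0 → ∀ x,
          v t x = UnboundedOperators.heatExtension (v s) (t - s) x - oseenDuhamel 1 s v v t x) →
      ∀ s < (0 : ℝ), AnalyticOnNhd ℝ (fracLapHalf (v s)) univ) :
    ∀ (C D K : ℝ) (v : ℝ → EuclideanSpace ℝ (Fin 3) → EuclideanSpace ℝ (Fin 3)), Literature.Analysis.FluidPDE.HasTypeITimeDecay C v → Literature.Analysis.FluidPDE.HasTypeIDecay D v → HasTypeIDerivDecay K v → ContinuousOn (Function.uncurry v) (Set.Iio (0 : ℝ) ×ˢ Set.univ) → (∀ s t : ℝ, s < t → t < 0 → ∀ x, v t x = Literature.Analysis.UnboundedOperators.heatExtension (v s) (t - s) x - Literature.Analysis.FluidPDE.oseenDuhamel 1 s v v t x) → (∀ t < 0, Literature.Analysis.FluidPDE.VectorCalculus.IsDivFree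 (v t)) → (∀ s < 0, ∃ U : Set (EuclideanSpace ℝ (Fin 3)), IsOpen U ∧ U.Nonempty ∧ ∀ z ∈ U, curl (v s) z = fracLapHalf (v s) z) → ¬ Literature.Analysis.FluidPDE.IsBackwardSingularPoint v 0 :=
  chiralProfileRigidity_of_B localHelicityLower localDissipationLower hB3 hB5a hΛ

/-- **The door `Target` of `r19/Sketch20v5.lean` (text verbatim) FROM K1, B3, B5a and the slice analyticity.** -/
theorem target_of_K1_B3_B5a
    (h₁ : ∀ (ν T : ℝ), 0 < ν → 0 < T → ∀ (u : ℝ → EuclideanSpace ℝ (Fin 3) → EuclideanSpace ℝ (Fin 3)) (p : ℝ → EuclideanSpace ℝ (Fin 3) → ℝ), Literature.Analysis.FluidPDE.IsClassicalNSSolutionOn (Set.Ico 0 T) ν 0 u p → Literature.Analysis.FluidPDE.IsLerayHopfOn T ν 0 (u 0) u → Literature.Analysis.FluidPDE.HasRapidSpatialDecay (u 0) → ∀ (x₀ : EuclideanSpace ℝ (Fin 3)) (ρ M : ℝ), 0 < ρ → (∀ t ∈ Set.Ico 0 T, T - ρ ^ 2 < t → ∀ x ∈ Metric.ball x₀ ρ,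 ‖u t x‖ * (‖x - x₀‖ + Real.sqrt (ν * (T - t))) ≤ M) → ∀ (U : Set (EuclideanSpace ℝ (Fin 3))), IsOpen U → U.Nonempty → Filter.Tendsto (fun t => ∫⁻ y in U, ENNReal.ofReal ‖(T - t) • (curl (u t) (x₀ + Real.sqrt (T - t) • y) - fracLapHalf (u t) (x₀ + Real.sqrt (T - t) • y))‖) (nhdsWithin T (Set.Iio T)) (nhds 0) → ¬ Literature.Analysis.FluidPDE.IsBackwardBoundedAt u T x₀ → ∃ (C D K : ℝ) (v : ℝ → EuclideanSpace ℝ (Fin 3) → EuclideanSpace ℝ (Fin 3)), Literature.Analysis.FluidPDE.HasTypeITimeDecay C v ∧ Literature.Analysis.FluidPDE.HasTypeIDecay D v ∧ HasTypeIDerivDecay K v ∧ ContinuousOn (Function.uncurry v) (Set.Iio (0 : ℝ) ×ˢ Set.univ) ∧ (∀ s t : ℝ, s < t → t < 0 → ∀ x, v t x = Literature.Analysis.UnboundedOperators.heatExtension (v s) (t - s) x - Literature.Analysis.FluidPDE.oseenDuhamel 1 s v v t x) ∧ (∀ t < 0, Literature.Analysis.FluidPDE.VectorCalculus.IsDivFree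 (v t)) ∧ Literature.Analysis.FluidPDE.IsBackwardSingularPoint v 0 ∧ (∀ s < 0, ∃ U : Set (EuclideanSpace ℝ (Fin 3)), IsOpen U ∧ U.Nonempty ∧ ∀ z ∈ U, curl (v s) z = fracLapHalf (v s) z))
    (hB3 : ∀ (η : EuclideanSpace ℝ (Fin 3) → ℝ), IsAdmissibleBump η → ∀ (C D K : ℝ)
      (v : ℝ → EuclideanSpace ℝ (Fin 3) → EuclideanSpace ℝ (Fin 3)),
      HasTypeITimeDecay C v → HasTypeIDecay D v → HasTypeIDerivDecay K v →
      ContinuousOn (Function.uncurry v) (Set.Iio (0 : ℝ) ×ˢ Set.univ) →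
      (∀ s t : ℝ, s < t → t < 0 → ∀ x,
          v t x = UnboundedOperators.heatExtension (v s) (t - s) x - oseenDuhamel 1 s v v t x) →
      (∀ t < 0, VectorCalculus.IsDivFree (v t)) →
      ∃ c : ℝ, ∀ R > (0 : ℝ), ∀ t₀ < (0 : ℝ),
        locHelicity (bumpSq η R) (v t₀) + 2 * ∫ t in Set.Iio t₀, locHelicity (bumpSq η R) (curl (v t)) ≤ c)
    (hB5a : ∀ (η : EuclideanSpace ℝ (Fin 3) → ℝ), IsAdmissibleBump η → ∀ (C D K : ℝ)
      (v : ℝ → EuclideanSpace ℝ (Fin 3) → EuclideanSpace ℝ (Fin 3)),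
      HasTypeITimeDecay C v → HasTypeIDecay D v → HasTypeIDerivDecay K v →
      ContinuousOn (Function.uncurry v) (Set.Iio (0 : ℝ) ×ˢ Set.univ) →
      (∃ c : ℝ, ∀ R > (0 : ℝ), ∀ t₀ < (0 : ℝ), gagliardo (bumpSq η R) (v t₀) ≤ c) →
      ∃ M : NNReal, ∀ t ∈ Set.Ioo (-1 : ℝ) 0,
        ∫⁻ x in Metric.ball (0 : EuclideanSpace ℝ (Fin 3)) 1, ‖v t x‖ₑ ^ (3 : ℕ) ≤ M)
    (hΛ : ∀ (C D K : ℝ) (v : ℝ → EuclideanSpace ℝ (Fin 3) → EuclideanSpace ℝ (Fin 3)),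
      HasTypeITimeDecay C v → HasTypeIDecay D v → HasTypeIDerivDecay K v →
      ContinuousOn (Function.uncurry v) (Set.Iio (0 : ℝ) ×ˢ Set.univ) →
      (∀ s t : ℝ, s < t → t < 0 → ∀ x,
          v t x = UnboundedOperators.heatExtension (v s) (t - s) x - oseenDuhamel 1 s v v t x) →
      ∀ s < (0 : ℝ), AnalyticOnNhd ℝ (fracLapHalf (v s)) univ) :
    ∀ (ν T : ℝ), 0 < ν → 0 < T → ∀ (u : ℝ → EuclideanSpace ℝ (Fin 3) → EuclideanSpace ℝ (Fin 3)) (p : ℝ → EuclideanSpace ℝ (Fin 3) → ℝ), Literature.Analysis.FluidPDE.IsClassicalNSSolutionOn (Set.Ico 0 T) ν 0 u p → Literature.Analysis.FluidPDE.IsLerayHopfOn T ν 0 (u 0) u → Literature.Analysis.FluidPDE.HasRapidSpatialDecay (u 0) → ∀ (x₀ : EuclideanSpace ℝ (Fin 3)) (ρ M : ℝ), 0 < ρ → (∀ t ∈ Set.Ico 0 T, T - ρ ^ 2 < t → ∀ x ∈ Metric.ball x₀ ρ, ‖u t x‖ * (‖x - x₀‖ + Real.sqrt (ν * (T - t)))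 ≤ M) → ∀ (U : Set (EuclideanSpace ℝ (Fin 3))), IsOpen U → U.Nonempty → Filter.Tendsto (fun t => ∫⁻ y in U, ENNReal.ofReal ‖(T - t) • (curl (u t) (x₀ + Real.sqrt (T - t) • y) - fracLapHalf (u t) (x₀ + Real.sqrt (T - t) • y))‖) (nhdsWithin T (Set.Iio T)) (nhds 0) → Literature.Analysis.FluidPDE.IsBackwardBoundedAt u T x₀ :=
  target_of h₁ (chiralProfileRigidity_of_B3_B5a hB3 hB5a hΛ)

end Summit.NavierStokesRegularity.NavierStokesRegularity.Theorems.ChiralWindowDoorProfileRigidityOfB3B5a
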